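import Mathlib
import Summits.ValiantsHypothesis.ValiantsHypothesis.Theorems.LacunarySymmetroidMatrixDescartesManyWindows
import Summits.ValiantsHypothesis.ValiantsHypothesis.Theorems.LacunarySymmetroidMatrixDescartesDominatedWindowEnds

/-!
# `MatrixDescartes` (stmt-ValiantsHypothesis-18050) — the DOMINATED SIGN-WORD LAW: a semidefinite sign word with
# `α` alternations whose sign boundaries dominate a covering family of `α` scale windows has `Z₊ ≤ α·card ι`

HONEST FRAMING.  Cell `pub-symmetroid`, seat `val-sym-mdr-p2` (gen 5); helper file `--supports` the crux
`Theses.LacunarySymmetroid.MatrixDescartes`.  It ASSEMBLES gen 4's window engine (`manyWindows_posRoots_le`) with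
the dominated-window lemmas (`dominatedWindow_mono`, `…_left`, `…_right`) into the `α`-general law announced in
those files' docstrings (the Cameron–Psarrakos count `n·α(P)` [CameronPsarrakos2019, display (6)] — FALSE
unconditionally by the tree's `DefiniteWitness.cameronPsarrakos_counterexample`, and here RESTORED under `2(α−1)`
endpoint-dominance hypotheses).  A K-free SECTOR law with magnitude hypotheses; nothing here bears on the crux in
its window, on `stub_twoSided`, on `DoorA26` / `DoorA34`, or on `VP ≠ VNP`.

THE LAW (`signWord_posRoots_le`).  `F = ∑ₗ X^{dₗ} Sₗ`, real symmetric `ι × ι` letters at strictly increasing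
exponents, grouped into consecutive BLOCKS by a monotone `blk : Fin K → ℕ` with values `≤ α` (`α ≥ 1`), block `b`
carrying the sign `(−1)^b`: `(−1)^{blk l} • S l ⪰ 0` for every `l` (block `0` PSD, block `1` NSD, …; the other global
sign is the same statement for `−F`, `roots_det_pencil_neg`).  Scales `0 = x₀ < x₁ ≤ ⋯ ≤ x_{α−1}`; window
`W_j = [x_j, x_{j+1}]` (`W₀ = (0, x₁]`, `W_{α−1} = [x_{α−1}, ∞)`) handles the `j`-th sign boundary (between blocks `j`
and `j+1`) with a PIVOT index `π j` (letters below it in blocks `≤ j`, letters above it in blocks `≥ j+1`), an upper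
DOMINATOR `μ j > π j` in block `j+1` (every `j < α`) and a lower dominator `μ' j < π j` in block `j` (every
`1 ≤ j < α`).  Writing `|S l| := (−1)^{blk l} S l ⪰ 0`, the hypotheses are the `2(α−1)` endpoint dominances
* (upper, `j + 1 < α`, at `b = x_{j+1}`): `(d_{μ j} − d_{π j})·|S_{μ j}| ⪰ ∑_{l > π j, blk l ∈ {j+2, j+4, …}} (d_l − d_{π j})·x_{j+1}^{d_l − d_{μ j}}·|S_l|`,
* (lower, `1 ≤ j`, at `a = x_j`):        `(d_{π j} − d_{μ' j})·|S_{μ' j}| ⪰ ∑_{l < π j, blk l ∈ {j−1, j−3, …}} (d_{π j} − d_l)·x_j^{−(d_{μ' j} − d_l)}·|S_l|`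
(the far blocks of the wrong monotonicity are dominated by ONE adjacent good letter at the window's endpoints; in
the statement the index sets are written `¬ Odd (j + blk l)` resp. `Odd (j + blk l)`).  CONCLUSION: `det F` has at
most `α · card ι` distinct positive zeros.  Proof: in window `j` the family `(−1)^{j+1}F/x^{d_{π j}}` is Loewner
non-decreasing by the dominated-window lemma (frame sign `(−1)^{j+1}` makes block `j` NSD and block `j+1` PSD), so
each window carries `≤ card ι` zeros (`manyWindows_posRoots_le`: clamped kernel data + inertia chain, either
monotonicity direction per window).  `α = 1` is the tree's `oneAlternation`, `α = 2` the tree's `dominantMiddle`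
(with pivots = top of the head / bottom of the tail); the present file is the induction-free general case.
LIMITATION (honest): pivots are LETTERS, so a middle boundary between two singleton blocks has no room for a
dominator on one side; rescale `X ↦ X²` and insert a zero letter at the odd exponent between them if needed (the
zero count is unchanged) — not done here.
[folklore] Mathlib + the tree lemmas named; axioms `propext`, `Classical.choice`, `Quot.sound`.
-/

-- layout Summits/ValiantsHypothesis/ValiantsHypothesis forces the duplicated namespace component
set_option linter.dupNamespace false

namespace Summit.ValiantsHypothesis.ValiantsHypothesis.Theorems.LacunarySymmetroidMatrixDescartes

open Polynomial Matrix Finset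
open scoped BigOperators

namespace SignWordLaw

variable {ι : Type} {K : ℕ}

/-- `(−1)^n • M = M` for even `n`. [folklore] -/
theorem negOnePow_smul_of_even {n : ℕ} (h : Even n) (M : Matrix ι ι ℝ) : ((-1 : ℝ) ^ n) • M = M := by
  rw [h.neg_one_pow, one_smul]

/-- `(−1)^n • M = −M` for odd `n`. [folklore] -/
theorem negOnePow_smul_of_odd {n : ℕ} (h : Odd n) (M : Matrix ι ι ℝ) : ((-1 : ℝ) ^ n) • M = -M := by
  rw [h.neg_one_pow, neg_smul, one_smul]

/-- Loewner non-decrease of `(−F)/w` is Loewner non-increase of `F/w` (letterwise form). [folklore] -/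
theorem anti_of_neg_mono (d : Fin K → ℕ) (S : Fin K → Matrix ι ι ℝ) (c₁ c₂ s t : ℝ)
    (h : ((c₁ • ∑ l, (t ^ d l) • (-S l)) - (c₂ • ∑ l, (s ^ d l) • (-S l))).PosSemidef) :
    ((c₂ • ∑ l, (s ^ d l) • S l) - (c₁ • ∑ l, (t ^ d l) • S l)).PosSemidef := by
  rwa [RegimeWindows.pencil_neg, RegimeWindows.pencil_neg, smul_neg, smul_neg, neg_sub_neg] at h

end SignWordLaw

open SignWordLaw in
/-- **DOMINATED SIGN-WORD LAW: `Z₊ ≤ α · card ι`.**  Letters `S l` (real symmetric, strictly increasing exponents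
`d`) grouped into blocks by a monotone `blk ≤ α` with `(−1)^{blk l} S l ⪰ 0`; scales `x` (`x 0 = 0`, monotone,
`x j > 0` for `j ≥ 1`); for each sign boundary `j < α` a pivot `π j` (letters below in blocks `≤ j`, above in blocks
`≥ j+1`), an upper dominator `μ j > π j` in block `j+1`, and for `j ≥ 1` a lower dominator `μ' j < π j` in block
`j`; endpoint dominances: at `x (j+1)` the letter `μ j` dominates the letters above the pivot in blocks
`j+2, j+4, …` (`j + 1 < α`), at `x j` the letter `μ' j` dominates the letters below the pivot in blocks
`j−1, j−3, …` (`1 ≤ j`).  Then `det (∑ X^{d l} S l)` has at most `α · card ι` distinct positive zeros.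
[CameronPsarrakos2019, display (6) — the count `n·α`, here under dominance; folklore assembly of the tree's
window engine] -/
theorem signWord_posRoots_le (ι : Type) [Fintype ι] [DecidableEq ι] {K : ℕ} (d : Fin K → ℕ)
    (hd : StrictMono d) (S : Fin K → Matrix ι ι ℝ) (hS : ∀ l, (S l).IsSymm)
    (blk : Fin K → ℕ) (hblk : Monotone blk) (α : ℕ) (hα : 1 ≤ α) (hblkα : ∀ l, blk l ≤ α)
    (hsign : ∀ l, (((-1 : ℝ) ^ blk l) • S l).PosSemidef)
    (x : ℕ → ℝ) (hxmono : Monotone x) (hx0 : x 0 = 0) (hxpos : ∀ j, 1 ≤ j → 0 < x j)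
    (π μ μ' : ℕ → Fin K)
    (hπB : ∀ j, j < α → ∀ l, l < π j → blk l ≤ j) (hπA : ∀ j, j < α → ∀ l, π j < l → j + 1 ≤ blk l)
    (hμ : ∀ j, j < α → π j < μ j ∧ blk (μ j) = j + 1)
    (hμ' : ∀ j, 1 ≤ j → j < α → μ' j < π j ∧ blk (μ' j) = j)
    (hdomA : ∀ j, j + 1 < α →
      ((((d (μ j) - d (π j) : ℕ) : ℝ)) • (((-1 : ℝ) ^ blk (μ j)) • S (μ j))
        - ∑ l ∈ univ.filter (fun l => π j < l ∧ ¬ Odd (j + blk l)),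
            (((d l - d (π j) : ℕ) : ℝ) * x (j + 1) ^ (d l - d (μ j))) • (((-1 : ℝ) ^ blk l) • S l)
        ).PosSemidef)
    (hdomB : ∀ j, 1 ≤ j → j < α →
      ((((d (π j) - d (μ' j) : ℕ) : ℝ)) • (((-1 : ℝ) ^ blk (μ' j)) • S (μ' j))
        - ∑ l ∈ univ.filter (fun l => l < π j ∧ Odd (j + blk l)),
            (((d (π j) - d l : ℕ) : ℝ) * (x j)⁻¹ ^ (d (μ' j) - d l)) • (((-1 : ℝ) ^ blk l) • S l)
        ).PosSemidef) :
    ((Matrix.det (∑ l, ((Polynomial.X : Polynomial ℝ) ^ d l) • (S l).map Polynomial.C)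
        ).roots.toFinset.filter (fun t => 0 < t)).card ≤ α * Fintype.card ι := by
  classical
  refine manyWindows_posRoots_le ι d S hS α hα x hxmono hx0 hxpos (fun j u => u ^ d (π j))
    (fun j _ u hu => pow_pos hu.1 _) fun j hj => ?_
  -- the frame of window `j`: `pos l := Odd (j + blk l)` (PSD in the frame `(−1)^{j+1} F`)
  -- block bookkeeping shared by both parities
  have hμpos : Odd (j + blk (μ j)) := by
    rw [(hμ j hj).2, ← add_assoc]; exact ⟨j, by ring⟩
  have hbadA : ∀ l, π j < l → ¬ Odd (j + blk l) → μ j < l := by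
    intro l hl hnodd
    have h1 : j + 1 ≤ blk l := hπA j hj l hl
    have hne : blk l ≠ j + 1 := by
      intro h; rw [h, ← add_assoc] at hnodd; exact hnodd ⟨j, by ring⟩
    by_contra hle
    push Not at hle
    have := hblk hle
    rw [(hμ j hj).2] at this
    omega
  have hbadB : 1 ≤ j → ∀ l, l < π j → Odd (j + blk l) → l < μ' j := by
    intro hj1 l hl hodd
    have h1 : blk l ≤ j := hπB j hj l hl
    have hne : blk l ≠ j := by
      intro h; rw [h] at hodd; exact (Nat.not_odd_iff_even.2 ⟨j, rfl⟩) hodd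
    by_contra hle
    push Not at hle
    have := hblk hle
    rw [(hμ' j hj1 hj).2] at this
    omega
  have hnoB0 : j = 0 → ∀ l, l < π j → ¬ Odd (j + blk l) := by
    intro hj0 l hl
    have h1 : blk l ≤ j := hπB j hj l hl
    have : blk l = 0 := by omega
    rw [this, hj0]; exact Nat.not_odd_iff_even.2 ⟨0, rfl⟩
  have hnoA : j + 1 = α → ∀ l, π j < l → Odd (j + blk l) := by
    intro hjα l hl
    have h1 : j + 1 ≤ blk l := hπA j hj l hl
    have h2 : blk l ≤ α := hblkα l
    have : blk l = j + 1 := by omega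
    rw [this, ← add_assoc]; exact ⟨j, by ring⟩
  have hμ'neg : 1 ≤ j → ¬ Odd (j + blk (μ' j)) := by
    intro hj1; rw [(hμ' j hj1 hj).2]; exact Nat.not_odd_iff_even.2 ⟨j, rfl⟩
  rcases Nat.even_or_odd j with hje | hjo
  · ---------------------------------------------------------------- `j` even: frame `−F`, non-increasing
    right
    -- letters of the frame
    have hsignT : ∀ l, l ≠ π j →
        (Odd (j + blk l) → (-S l).PosSemidef) ∧ (¬ Odd (j + blk l) → (-(-S l)).PosSemidef) := by
      intro l _
      refine ⟨fun hodd => ?_, fun hnodd => ?_⟩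
      · have hbo : Odd (blk l) := by
          rcases Nat.even_or_odd (blk l) with h | h
          · exact absurd (hje.add h) (Nat.not_even_iff_odd.2 hodd)
          · exact h
        have := hsign l; rwa [negOnePow_smul_of_odd hbo] at this
      · have hbe : Even (blk l) := by
          rcases Nat.even_or_odd (blk l) with h | h
          · exact h
          · exact absurd (hje.add_odd h) hnodd
        have := hsign l; rwa [negOnePow_smul_of_even hbe, ← neg_neg (S l)] at this
    have hT : ∀ l, (-S l).IsSymm := fun l => (hS l).neg
    -- upper dominance in the frame (when `j + 1 < α`)
    have hdomA' : j + 1 < α →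
        ((((d (μ j) - d (π j) : ℕ) : ℝ)) • (-S (μ j))
          - ∑ l ∈ univ.filter (fun l => π j < l ∧ ¬ Odd (j + blk l)),
              (((d l - d (π j) : ℕ) : ℝ) * x (j + 1) ^ (d l - d (μ j))) • (-(-S l))).PosSemidef := by
      intro hjα
      have hbo : Odd (blk (μ j)) := by rw [(hμ j hj).2]; exact hje.add_one
      have e1 : ((-1 : ℝ) ^ blk (μ j)) • S (μ j) = -S (μ j) := negOnePow_smul_of_odd hbo _
      have e2 : ∀ l ∈ univ.filter (fun l => π j < l ∧ ¬ Odd (j + blk l)),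
          (((d l - d (π j) : ℕ) : ℝ) * x (j + 1) ^ (d l - d (μ j))) • (((-1 : ℝ) ^ blk l) • S l)
            = (((d l - d (π j) : ℕ) : ℝ) * x (j + 1) ^ (d l - d (μ j))) • (-(-S l)) := by
        intro l hl
        have hnodd := (Finset.mem_filter.1 hl).2.2
        have hbe : Even (blk l) := by
          rcases Nat.even_or_odd (blk l) with h | h
          · exact h
          · exact absurd (hje.add_odd h) hnodd
        rw [negOnePow_smul_of_even hbe, neg_neg]
      have h0 := hdomA j hjα
      rwa [e1, Finset.sum_congr rfl e2] at h0
    -- lower dominance in the frame (when `1 ≤ j`)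
    have hdomB' : 1 ≤ j →
        ((((d (π j) - d (μ' j) : ℕ) : ℝ)) • (-(-S (μ' j)))
          - ∑ l ∈ univ.filter (fun l => l < π j ∧ Odd (j + blk l)),
              (((d (π j) - d l : ℕ) : ℝ) * (x j)⁻¹ ^ (d (μ' j) - d l)) • (-S l)).PosSemidef := by
      intro hj1
      have hbe : Even (blk (μ' j)) := by rw [(hμ' j hj1 hj).2]; exact hje
      have e1 : ((-1 : ℝ) ^ blk (μ' j)) • S (μ' j) = -(-S (μ' j)) := by
        rw [negOnePow_smul_of_even hbe, neg_neg]
      have e2 : ∀ l ∈ univ.filter (fun l => l < π j ∧ Odd (j + blk l)),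
          (((d (π j) - d l : ℕ) : ℝ) * (x j)⁻¹ ^ (d (μ' j) - d l)) • (((-1 : ℝ) ^ blk l) • S l)
            = (((d (π j) - d l : ℕ) : ℝ) * (x j)⁻¹ ^ (d (μ' j) - d l)) • (-S l) := by
        intro l hl
        have hodd := (Finset.mem_filter.1 hl).2.2
        have hbo : Odd (blk l) := by
          rcases Nat.even_or_odd (blk l) with h | h
          · exact absurd (hje.add h) (Nat.not_even_iff_odd.2 hodd)
          · exact h
        rw [negOnePow_smul_of_odd hbo]
      have h0 := hdomB j hj1 hj
      rwa [e1, Finset.sum_congr rfl e2] at h0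
    intro s t hs ht hst
    apply anti_of_neg_mono d S
    by_cases hj0 : j = 0
    · -- first window `(0, x₁]` (or `(0, ∞)` when `α = 1`): no bad letters below
      subst hj0
      by_cases hα1 : (0:ℕ) + 1 < α
      · exact dominatedWindow_mono_left d hd (fun l => -S l) hT (π 0) (μ 0) (hμ 0 hj).1
          (fun l => Odd (0 + blk l)) hμpos hsignT (hnoB0 rfl) hbadA (x (0 + 1)) (hdomA' hα1) s t hs.1
          hst (ht.2.2 hα1)
      · -- `α = 1`: the upper dominance is vacuous (no block beyond `1`), take `b := t`
        have hα1' : 0 + 1 = α := by omega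
        have hdomA'' : ((((d (μ 0) - d (π 0) : ℕ) : ℝ)) • (-S (μ 0))
            - ∑ l ∈ univ.filter (fun l => π 0 < l ∧ ¬ Odd (0 + blk l)),
                (((d l - d (π 0) : ℕ) : ℝ) * t ^ (d l - d (μ 0))) • (-(-S l))).PosSemidef := by
          have hempty : univ.filter (fun l => π 0 < l ∧ ¬ Odd (0 + blk l)) = ∅ := by
            refine Finset.filter_eq_empty_iff.2 fun l _ h => h.2 (hnoA hα1' l h.1)
          rw [hempty, Finset.sum_empty, sub_zero]
          exact ((hsignT (μ 0) (ne_of_gt (hμ 0 hj).1)).1 hμpos).smul (Nat.cast_nonneg _)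
        exact dominatedWindow_mono_left d hd (fun l => -S l) hT (π 0) (μ 0) (hμ 0 hj).1
          (fun l => Odd (0 + blk l)) hμpos hsignT (hnoB0 rfl) hbadA t hdomA'' s t hs.1 hst le_rfl
    · have hj1 : 1 ≤ j := Nat.one_le_iff_ne_zero.2 hj0
      by_cases hjα : j + 1 < α
      · -- middle window `[x_j, x_{j+1}]`
        exact dominatedWindow_mono d hd (fun l => -S l) hT (π j) (μ j) (μ' j) (hμ' j hj1 hj).1 (hμ j hj).1
          (fun l => Odd (j + blk l)) (hμ'neg hj1) hμpos hsignT (hbadB hj1) hbadA (x j) (x (j + 1))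
          (hxpos j hj1) (hdomB' hj1) (hdomA' hjα) s t hs.2.1 hst (ht.2.2 hjα)
      · -- last window `[x_j, ∞)`: no bad letters above
        have hjα' : j + 1 = α := by omega
        exact dominatedWindow_mono_right d hd (fun l => -S l) hT (π j) (μ' j) (hμ' j hj1 hj).1
          (fun l => Odd (j + blk l)) (hμ'neg hj1) hsignT (hbadB hj1) (hnoA hjα') (x j) (hxpos j hj1)
          (hdomB' hj1) s t hs.2.1 hst
  · ---------------------------------------------------------------- `j` odd: frame `F`, non-decreasing
    left
    have hj1 : 1 ≤ j := hjo.pos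
    have hsignT : ∀ l, l ≠ π j →
        (Odd (j + blk l) → (S l).PosSemidef) ∧ (¬ Odd (j + blk l) → (-S l).PosSemidef) := by
      intro l _
      refine ⟨fun hodd => ?_, fun hnodd => ?_⟩
      · have hbe : Even (blk l) := by
          rcases Nat.even_or_odd (blk l) with h | h
          · exact h
          · exact absurd (hjo.add_odd h) (Nat.not_even_iff_odd.2 hodd)
        have := hsign l; rwa [negOnePow_smul_of_even hbe] at this
      · have hbo : Odd (blk l) := by
          rcases Nat.even_or_odd (blk l) with h | h
          · exact absurd (hjo.add_even h) hnodd
          · exact h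
        have := hsign l; rwa [negOnePow_smul_of_odd hbo] at this
    have hdomA' : j + 1 < α →
        ((((d (μ j) - d (π j) : ℕ) : ℝ)) • S (μ j)
          - ∑ l ∈ univ.filter (fun l => π j < l ∧ ¬ Odd (j + blk l)),
              (((d l - d (π j) : ℕ) : ℝ) * x (j + 1) ^ (d l - d (μ j))) • (-S l)).PosSemidef := by
      intro hjα
      have hbe : Even (blk (μ j)) := by rw [(hμ j hj).2]; exact hjo.add_one
      have e1 : ((-1 : ℝ) ^ blk (μ j)) • S (μ j) = S (μ j) := negOnePow_smul_of_even hbe _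
      have e2 : ∀ l ∈ univ.filter (fun l => π j < l ∧ ¬ Odd (j + blk l)),
          (((d l - d (π j) : ℕ) : ℝ) * x (j + 1) ^ (d l - d (μ j))) • (((-1 : ℝ) ^ blk l) • S l)
            = (((d l - d (π j) : ℕ) : ℝ) * x (j + 1) ^ (d l - d (μ j))) • (-S l) := by
        intro l hl
        have hnodd := (Finset.mem_filter.1 hl).2.2
        have hbo : Odd (blk l) := by
          rcases Nat.even_or_odd (blk l) with h | h
          · exact absurd (hjo.add_even h) hnodd
          · exact h
        rw [negOnePow_smul_of_odd hbo]
      have h0 := hdomA j hjα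
      rwa [e1, Finset.sum_congr rfl e2] at h0
    have hdomB' :
        ((((d (π j) - d (μ' j) : ℕ) : ℝ)) • (-S (μ' j))
          - ∑ l ∈ univ.filter (fun l => l < π j ∧ Odd (j + blk l)),
              (((d (π j) - d l : ℕ) : ℝ) * (x j)⁻¹ ^ (d (μ' j) - d l)) • S l).PosSemidef := by
      have hbo : Odd (blk (μ' j)) := by rw [(hμ' j hj1 hj).2]; exact hjo
      have e1 : ((-1 : ℝ) ^ blk (μ' j)) • S (μ' j) = -S (μ' j) := negOnePow_smul_of_odd hbo _
      have e2 : ∀ l ∈ univ.filter (fun l => l < π j ∧ Odd (j + blk l)),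
          (((d (π j) - d l : ℕ) : ℝ) * (x j)⁻¹ ^ (d (μ' j) - d l)) • (((-1 : ℝ) ^ blk l) • S l)
            = (((d (π j) - d l : ℕ) : ℝ) * (x j)⁻¹ ^ (d (μ' j) - d l)) • S l := by
        intro l hl
        have hodd := (Finset.mem_filter.1 hl).2.2
        have hbe : Even (blk l) := by
          rcases Nat.even_or_odd (blk l) with h | h
          · exact h
          · exact absurd (hjo.add_odd h) (Nat.not_even_iff_odd.2 hodd)
        rw [negOnePow_smul_of_even hbe]
      have h0 := hdomB j hj1 hj
      rwa [e1, Finset.sum_congr rfl e2] at h0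
    intro s t hs ht hst
    by_cases hjα : j + 1 < α
    · -- middle window
      exact dominatedWindow_mono d hd S hS (π j) (μ j) (μ' j) (hμ' j hj1 hj).1 (hμ j hj).1
        (fun l => Odd (j + blk l)) (hμ'neg hj1) hμpos hsignT (hbadB hj1) hbadA (x j) (x (j + 1))
        (hxpos j hj1) hdomB' (hdomA' hjα) s t hs.2.1 hst (ht.2.2 hjα)
    · -- last window
      have hjα' : j + 1 = α := by omega
      exact dominatedWindow_mono_right d hd S hS (π j) (μ' j) (hμ' j hj1 hj).1
        (fun l => Odd (j + blk l)) (hμ'neg hj1) hsignT (hbadB hj1) (hnoA hjα') (x j) (hxpos j hj1)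
        hdomB' s t hs.2.1 hst

end Summit.ValiantsHypothesis.ValiantsHypothesis.Theorems.LacunarySymmetroidMatrixDescartes
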